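import Literature.NumberTheory.DiophantineGeometry.AbcStewartYu2001
import Literature.Barriers.ABC.BakerMethodBoundsStewartYu1991LineProofs
import Mathlib.Analysis.Convex.Jensen
import Mathlib.Analysis.Convex.SpecificFunctions.Basic
import HarnessLib

/-!
# Stewart–Yu 2001, Theorem 2 from the place bounds, I: analysis on the primes of the radical

`Literature/NumberTheory/DiophantineGeometry/AbcStewartYu2001PlaceBoundsAnalysis.lean` — proofs
companion (theorems only; no definition, no named fact) of `AbcStewartYu2001.lean`, whose one named
fact `stewartYu2001_thm2` is Stewart–Yu 2001, Theorem 2: `z < exp(p′ · G^{c log₃ G⋆ / log₂ G})`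
for coprime positive `x + y = z`, `z > 2`, `G = rad(xyz)`, `G⋆ = max(G, 16)`,
`p′ = min{P(x), P(y), P(z)}` [cite: StewartYu2001, Theorem 2] [cite: Gyory2008, p. 282 (1.3)].
The sequel `AbcStewartYu2001PlaceBoundsProofs.lean` derives that fact from the three PLACE BOUNDS
which are the hypotheses of `Literature.Barriers.ABC.BakerMethodBounds_of_placeBounds` (the tree's
deduction of Theorem 1); its per-triple step ends in `log z < p′ · Q(G)` with
`Q(G) = 128 · (K^{ω+1} Π)² · ω² · log G`, where `ω = ω(G)` is the number of primes of the radical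
`G = ∏_{q ∈ S} q` and `Π = ∏_{q ∈ S} log max(4, q)`. This file proves the ABSORPTION
`Q(G) ≤ G^{C log₃ G⋆ / log₂ G} = G^{thm2Exponent C G}` (`StewartYu2001.absorb`), i.e. the two
facts about a square-free `G` behind the printed exponent `log₃ G⋆ / log₂ G`:

* `card_le_thirty_mul_log_div` (private) — `ω ≤ 30 log G / log₂ G` (`log G > 1`), from the
  Lemma-4 inequality `ω^ω Π ≤ 15^ω G` of the 1991 line
  (`Literature.Barriers.ABC.card_pow_card_mul_prod_log_le`) [cite: StewartYu1991, Lemma 4 (shape)];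
* `sum_log_log_le` (private) — `∑_{q ∈ S} log log max(4, q) ≤ (30 log G / log₂ G)(log₃⁺ G + 1)`:
  Jensen's inequality for the concave `log` (Mathlib's `ConcaveOn.le_map_sum`,
  `strictConcaveOn_log_Ioi`) gives `Π ≤ (2 log G / ω)^ω` — the AM–GM step
  `∏_{p ∣ abc} log p ≤ (log N / t)^t` printed as [cite: Gyory2008, p. 287 (3.13)] — and then the
  bound on `ω`;

followed by the bookkeeping `StewartYu2001.absorb` with the explicit constant
`C = (129 + 62 log K) / log₃ 16 + 60` in the unit `E = (log G / log₂ G) · log₃ G⋆ ≥ log₃ 16 > 0`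
(`StewartYu2001.log_log_log_pos`). Everything here is elementary real analysis ([folklore]); the
number theory enters only through `ω^ω ≪^ω G`.

## References

* [StewartYu2001] C. L. Stewart, K. Yu, *On the abc conjecture, II*, Duke Math. J. 108 (2001),
  169–181 — Theorem 2 (cite-only in the tree; typed from the secondaries in `AbcStewartYu2001.lean`).
* [Gyory2008] K. Győry, *On the abc conjecture in algebraic number fields*, Acta Arith. 133 (2008),
  281–295 — p. 282 (1.3) (the statement), p. 287 (3.12)–(3.13) (the shape
  `log c < 2^{10t+22} t⁴ (P / log⋆ P) ∏_{p ∣ abc} log p` and `∏_{p ∣ abc} log p ≤ (log N / t)^t`).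
* [StewartYu1991] C. L. Stewart, K. Yu, *On the abc conjecture*, Math. Ann. 291 (1991), 225–230 —
  Lemma 4.
-/

noncomputable section

open Finset Real
open Literature.Barriers.ABC

namespace Literature.NumberTheory.DiophantineGeometry

namespace StewartYu2001

/-! ### Analysis on a finite set of primes: `ω ≪ log G / log₂ G` and `∑ log log q ≪ (log G / log₂ G) log₃ G` -/

/-- `log x ≤ 2 √x` for `x ≥ 0`. [folklore] -/
private theorem log_le_two_mul_sqrt {x : ℝ} (hx : 0 ≤ x) : Real.log x ≤ 2 * Real.sqrt x := by
  have h := Real.log_le_rpow_div hx (by norm_num : (0 : ℝ) < 1 / 2)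
  have h2 : x ^ (1 / 2 : ℝ) / (1 / 2) = 2 * Real.sqrt x := by
    rw [Real.sqrt_eq_rpow]; ring
  linarith [h2]

/-- **`ω(G) ≤ 30 log G / log₂ G`.** For a finite set `S` of primes with `G = ∏_{q ∈ S} q` and
`log G > 1`: `#S ≤ 30 · log G / log log G`. From the Lemma-4 inequality of the 1991 line,
`#S^{#S} · ∏_{q ∈ S} log max(4, q) ≤ 15^{#S} · G` (`card_pow_card_mul_prod_log_le`): either
`#S ≤ 15 √(log G)` (and `√L · log L ≤ 2L`), or `log #S > log 15 + ½ log log G` and then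
`#S · ½ log log G < log G`. [folklore] -/
private theorem card_le_thirty_mul_log_div {S : Finset ℕ} (hS : ∀ q ∈ S, q.Prime)
    (hL : 1 < Real.log (∏ q ∈ S, (q : ℝ))) :
    (S.card : ℝ) ≤ 30 * Real.log (∏ q ∈ S, (q : ℝ)) / Real.log (Real.log (∏ q ∈ S, (q : ℝ))) := by
  set G := ∏ q ∈ S, (q : ℝ) with hG
  set L := Real.log G with hLdef
  have hL0 : 0 < L := by linarith
  have hu0 : 0 < Real.log L := Real.log_pos hL
  have hsqrt0 : 0 < Real.sqrt L := Real.sqrt_pos.mpr hL0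
  have hsl : Real.sqrt L * Real.log L ≤ 2 * L := by
    have h1 := log_le_two_mul_sqrt hL0.le
    calc Real.sqrt L * Real.log L ≤ Real.sqrt L * (2 * Real.sqrt L) :=
          mul_le_mul_of_nonneg_left h1 hsqrt0.le
      _ = 2 * (Real.sqrt L * Real.sqrt L) := by ring
      _ = 2 * L := by rw [Real.mul_self_sqrt hL0.le]
  rw [le_div_iff₀ hu0]
  by_cases hcase : (S.card : ℝ) ≤ 15 * Real.sqrt L
  · calc (S.card : ℝ) * Real.log L ≤ 15 * Real.sqrt L * Real.log L :=
          mul_le_mul_of_nonneg_right hcase hu0.le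
      _ = 15 * (Real.sqrt L * Real.log L) := by ring
      _ ≤ 15 * (2 * L) := by linarith [hsl]
      _ = 30 * L := by ring
  · push Not at hcase
    have hω0 : (0 : ℝ) < S.card := lt_trans (by positivity) hcase
    have hG0 : 0 < G := Finset.prod_pos fun q hq => by exact_mod_cast (hS q hq).pos
    -- Lemma 4: `ω^ω · ∏ log max(4,q) ≤ 15^ω · G`, and the product is `≥ 1`
    have h4 := card_pow_card_mul_prod_log_le hS
    have hPL := one_le_prod_log_max_four S
    have hωω : (S.card : ℝ) ^ S.card ≤ 15 ^ S.card * G := by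
      calc (S.card : ℝ) ^ S.card = (S.card : ℝ) ^ S.card * 1 := (mul_one _).symm
        _ ≤ (S.card : ℝ) ^ S.card * ∏ q ∈ S, Real.log ((max 4 q : ℕ) : ℝ) :=
            mul_le_mul_of_nonneg_left hPL (pow_nonneg (Nat.cast_nonneg _) _)
        _ ≤ 15 ^ S.card * G := h4
    have hlog : (S.card : ℝ) * Real.log (S.card : ℝ) ≤ S.card * Real.log 15 + L := by
      have := Real.log_le_log (pow_pos hω0 S.card) hωω
      rw [Real.log_pow, Real.log_mul (pow_pos (by norm_num : (0 : ℝ) < 15) S.card).ne' hG0.ne',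
        Real.log_pow] at this
      exact this
    have hlogω : Real.log 15 + Real.log L / 2 < Real.log (S.card : ℝ) := by
      have h1 : Real.log (15 * Real.sqrt L) < Real.log (S.card : ℝ) :=
        Real.log_lt_log (by positivity) hcase
      rw [Real.log_mul (by norm_num) hsqrt0.ne', Real.log_sqrt hL0.le] at h1
      exact h1
    have h2 : (S.card : ℝ) * (Real.log 15 + Real.log L / 2) < S.card * Real.log 15 + L :=
      (mul_lt_mul_of_pos_left hlogω hω0).trans_le hlog
    have h3 : (S.card : ℝ) * (Real.log 15 + Real.log L / 2) =
        S.card * Real.log 15 + (S.card * Real.log L) / 2 := by ring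
    rw [h3] at h2
    linarith

/-- `log max(4, q) ≤ 2 log q` for a prime `q` (`max(4, q) ≤ q²`). [folklore] -/
private theorem log_max_four_le {q : ℕ} (hq : q.Prime) :
    Real.log ((max 4 q : ℕ) : ℝ) ≤ 2 * Real.log q := by
  have hq2 := hq.two_le
  have h : ((max 4 q : ℕ) : ℝ) ≤ (q : ℝ) ^ 2 := by
    have : max 4 q ≤ q ^ 2 := by
      rcases le_or_gt 4 q with h4 | h4
      · rw [max_eq_right h4]; nlinarith
      · rw [max_eq_left h4.le]; nlinarith
    exact_mod_cast this
  have h0 : (0 : ℝ) < ((max 4 q : ℕ) : ℝ) := by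
    exact_mod_cast lt_of_lt_of_le (by norm_num : 0 < 4) (le_max_left 4 q)
  calc Real.log ((max 4 q : ℕ) : ℝ) ≤ Real.log ((q : ℝ) ^ 2) := Real.log_le_log h0 h
    _ = 2 * Real.log q := by rw [Real.log_pow]; norm_num

/-- `0 < log max(4, q)`. [folklore] -/
private theorem log_max_four_pos (q : ℕ) : 0 < Real.log ((max 4 q : ℕ) : ℝ) :=
  Real.log_pos (by exact_mod_cast lt_of_lt_of_le (by norm_num : 1 < 4) (le_max_left 4 q))

/-- **`∑_{q ∣ G} log log q ≪ (log G / log₂ G) · (log₃⁺ G + 1)`.** For a finite set `S` of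
primes, `G = ∏ q`, `L = log G > 1`:
`∑_{q ∈ S} log log max(4, q) ≤ (30 L / log L) · (max(0, log log L) + 1)`.
Jensen's inequality for the concave `log` gives `∑ log t_q ≤ #S · log(∑ t_q / #S) ≤ #S log(2L/#S)`
(`t_q = log max(4,q)`, `∑ t_q ≤ 2L`); then with `W = 30 L / log L ≥ #S`
(`card_le_thirty_mul_log_div`): `#S log(2L/#S) = #S log(log L / 15) + #S log(W/#S) ≤ W log⁺log L + W`.
[folklore] -/
private theorem sum_log_log_le {S : Finset ℕ} (hS : ∀ q ∈ S, q.Prime)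
    (hL : 1 < Real.log (∏ q ∈ S, (q : ℝ))) :
    ∑ q ∈ S, Real.log (Real.log ((max 4 q : ℕ) : ℝ)) ≤
      30 * Real.log (∏ q ∈ S, (q : ℝ)) / Real.log (Real.log (∏ q ∈ S, (q : ℝ))) *
        (max 0 (Real.log (Real.log (Real.log (∏ q ∈ S, (q : ℝ))))) + 1) := by
  set G := ∏ q ∈ S, (q : ℝ) with hG
  set L := Real.log G with hLdef
  set W := 30 * L / Real.log L with hWdef
  have hL0 : 0 < L := by linarith
  have hu0 : 0 < Real.log L := Real.log_pos hL
  have hW0 : 0 < W := by positivity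
  have hωW : (S.card : ℝ) ≤ W := card_le_thirty_mul_log_div hS hL
  have hm0 : 0 ≤ max 0 (Real.log (Real.log L)) := le_max_left _ _
  rcases S.eq_empty_or_nonempty with h0 | hne
  · rw [h0, Finset.sum_empty]; positivity
  have hω0 : (0 : ℝ) < S.card := by exact_mod_cast Finset.card_pos.mpr hne
  have hωne : (S.card : ℝ) ≠ 0 := hω0.ne'
  have hune : Real.log L ≠ 0 := hu0.ne'
  -- `∑ t_q ≤ 2L`
  have hsumlog : ∑ q ∈ S, Real.log (q : ℝ) = L := by
    rw [hLdef, hG, Real.log_prod]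
    intro q hq
    exact_mod_cast (hS q hq).ne_zero
  have hsumt : ∑ q ∈ S, Real.log ((max 4 q : ℕ) : ℝ) ≤ 2 * L := by
    calc ∑ q ∈ S, Real.log ((max 4 q : ℕ) : ℝ) ≤ ∑ q ∈ S, 2 * Real.log (q : ℝ) :=
          Finset.sum_le_sum fun q hq => log_max_four_le (hS q hq)
      _ = 2 * L := by rw [← Finset.mul_sum, hsumlog]
  -- Jensen
  have hJ := (strictConcaveOn_log_Ioi.concaveOn).le_map_sum
    (t := S) (w := fun _ => 1 / (S.card : ℝ)) (p := fun q => Real.log ((max 4 q : ℕ) : ℝ))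
    (fun _ _ => by positivity)
    (by rw [Finset.sum_const, nsmul_eq_mul]; field_simp)
    (fun q _ => log_max_four_pos q)
  simp only [smul_eq_mul] at hJ
  rw [← Finset.mul_sum, ← Finset.mul_sum] at hJ
  have hst0 : 0 < ∑ q ∈ S, Real.log ((max 4 q : ℕ) : ℝ) :=
    Finset.sum_pos (fun q _ => log_max_four_pos q) hne
  have h3 : Real.log (1 / (S.card : ℝ) * ∑ q ∈ S, Real.log ((max 4 q : ℕ) : ℝ)) ≤
      Real.log (2 * L / S.card) := by
    apply Real.log_le_log (by positivity)
    rw [one_div_mul_eq_div]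
    exact div_le_div_of_nonneg_right hsumt hω0.le
  have h4 : ∑ q ∈ S, Real.log (Real.log ((max 4 q : ℕ) : ℝ)) ≤
      S.card * Real.log (2 * L / S.card) := by
    have h5 := hJ.trans h3
    rw [one_div_mul_eq_div, div_le_iff₀ hω0] at h5
    linarith
  -- `2L/ω = (log L / 15) · (W / ω)`
  have h6 : Real.log (2 * L / S.card) =
      Real.log (Real.log L / 15) + Real.log (W / S.card) := by
    rw [← Real.log_mul (by positivity) (by positivity)]
    congr 1
    rw [hWdef]
    field_simp
    ring
  have h7 : (S.card : ℝ) * Real.log (W / S.card) ≤ W := by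
    have h8 := Real.log_le_sub_one_of_pos (show 0 < W / S.card by positivity)
    have h9 : (S.card : ℝ) * (W / S.card - 1) = W - S.card := by field_simp
    nlinarith [mul_le_mul_of_nonneg_left h8 hω0.le]
  have h9 : (S.card : ℝ) * Real.log (Real.log L / 15) ≤ W * max 0 (Real.log (Real.log L)) := by
    rcases le_or_gt (Real.log (Real.log L / 15)) 0 with hneg | hpos
    · calc (S.card : ℝ) * Real.log (Real.log L / 15) ≤ 0 := by nlinarith
        _ ≤ W * max 0 (Real.log (Real.log L)) := by positivity
    · calc (S.card : ℝ) * Real.log (Real.log L / 15) ≤ W * Real.log (Real.log L / 15) :=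
            mul_le_mul_of_nonneg_right hωW hpos.le
        _ ≤ W * Real.log (Real.log L) := by
            apply mul_le_mul_of_nonneg_left _ hW0.le
            exact Real.log_le_log (by positivity) (by linarith)
        _ ≤ W * max 0 (Real.log (Real.log L)) :=
            mul_le_mul_of_nonneg_left (le_max_right _ _) hW0.le
  calc ∑ q ∈ S, Real.log (Real.log ((max 4 q : ℕ) : ℝ))
      ≤ S.card * Real.log (2 * L / S.card) := h4
    _ = S.card * Real.log (Real.log L / 15) + S.card * Real.log (W / S.card) := by rw [h6]; ring
    _ ≤ W * max 0 (Real.log (Real.log L)) + W := add_le_add h9 h7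
    _ = W * (max 0 (Real.log (Real.log L)) + 1) := by ring

/-! ### Absorption into `G^{c log₃ G⋆ / log₂ G}` -/

/-- `log₃ 16 ≤ log₃ max(G, 16)`. [folklore] -/
private theorem log₃_sixteen_le (G : ℝ) :
    Real.log (Real.log (Real.log 16)) ≤ Real.log (Real.log (Real.log (max G 16))) := by
  have h16 : (16 : ℝ) ≤ max G 16 := le_max_right _ _
  have hlog16 : 1 < Real.log 16 := by
    rw [← Real.log_exp 1]
    refine Real.log_lt_log (Real.exp_pos 1) ?_
    have := Real.exp_one_lt_d9
    linarith
  have hll16 : 0 < Real.log (Real.log 16) := Real.log_pos hlog16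
  have h1 : Real.log 16 ≤ Real.log (max G 16) := Real.log_le_log (by norm_num) h16
  have h2 : Real.log (Real.log 16) ≤ Real.log (Real.log (max G 16)) :=
    Real.log_le_log (by linarith) h1
  exact Real.log_le_log hll16 h2

/-- `max(0, log log L) ≤ log₃ max(G, 16)` for `L = log G > 1`, `G > 0`. [folklore] -/
private theorem max_zero_log_log_le {G : ℝ} (hG : 0 < G) (hL : 1 < Real.log G) :
    max 0 (Real.log (Real.log (Real.log G))) ≤ Real.log (Real.log (Real.log (max G 16))) := by
  refine max_le ((log_log_log_pos le_rfl).le.trans (log₃_sixteen_le G)) ?_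
  have hL0 : 0 < Real.log G := by linarith
  have hu0 : 0 < Real.log (Real.log G) := Real.log_pos hL
  have h1 : Real.log G ≤ Real.log (max G 16) := Real.log_le_log hG (le_max_left _ _)
  have h2 : Real.log (Real.log G) ≤ Real.log (Real.log (max G 16)) := Real.log_le_log hL0 h1
  exact Real.log_le_log hu0 h2

/-- `log L ≤ 4 L / log L` for `L > 1` (`(log L)² ≤ 4L`). [folklore] -/
private theorem log_le_four_mul_div_log {L : ℝ} (hL : 1 < L) : Real.log L ≤ 4 * L / Real.log L := by
  have hL0 : 0 < L := by linarith
  have hu0 : 0 < Real.log L := Real.log_pos hL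
  rw [le_div_iff₀ hu0]
  have h1 := log_le_two_mul_sqrt hL0.le
  calc Real.log L * Real.log L ≤ (2 * Real.sqrt L) * (2 * Real.sqrt L) :=
        mul_le_mul h1 h1 hu0.le (by positivity)
    _ = 4 * (Real.sqrt L * Real.sqrt L) := by ring
    _ = 4 * L := by rw [Real.mul_self_sqrt hL0.le]

/-- `1 ≤ log max(4, q)`. [folklore] -/
private theorem one_le_log_max_four (q : ℕ) : 1 ≤ Real.log ((max 4 q : ℕ) : ℝ) := by
  rw [← Real.log_exp 1]
  apply Real.log_le_log (Real.exp_pos 1)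
  have h4 : (4 : ℝ) ≤ ((max 4 q : ℕ) : ℝ) := by exact_mod_cast le_max_left 4 q
  have := Real.exp_one_lt_d9
  linarith

/-- **Absorption into `G^{c log₃ G⋆ / log₂ G}`.** For `K ≥ 1` there is `C > 0` such that for every
finite set `S` of primes with `G = ∏_{q ∈ S} q ≥ 6` (`ω = #S`, `Π = ∏_{q ∈ S} log max(4, q)`):
`128 · (K^{ω+1} Π)² · ω² · log G ≤ G^{thm2Exponent C G} = G^{C log₃ G⋆ / log₂ G}` (`G⋆ = max(G, 16)`).
With `E = (log G / log₂ G) · log₃ G⋆ ≥ log₃ 16 > 0`, each of `log 128`, `(ω+1) log K`, `log Π`,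
`log ω`, `log₂ G` is `≪_K E` (`card_le_thirty_mul_log_div`, `sum_log_log_le`,
`log_le_four_mul_div_log`); explicitly `C = (129 + 62 log K) / log₃ 16 + 60`. This is the
absorption step of the deduction of Theorem 2 — the passage from a bound of the shape
`(exponential in ω) · (P-factor) · ∏_{p ∣ G} log p` to `G^{c log₃ G⋆ / log₂ G}` via
`∏_{p ∣ G} log p ≤ (log G / ω)^ω`, as printed in Győry's report of it.
[cite: Gyory2008, p. 287 (3.12)–(3.13)] [cite: StewartYu2001, Theorem 2 (deduction)] -/
theorem absorb {K : ℝ} (hK : 1 ≤ K) :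
    ∃ C : ℝ, 0 < C ∧ ∀ S : Finset ℕ, (∀ q ∈ S, q.Prime) → (6 : ℝ) ≤ ∏ q ∈ S, (q : ℝ) →
      128 * (K ^ (S.card + 1) * ∏ q ∈ S, Real.log ((max 4 q : ℕ) : ℝ)) ^ 2 *
          (S.card : ℝ) ^ 2 * Real.log (∏ q ∈ S, (q : ℝ)) ≤
        (∏ q ∈ S, (q : ℝ)) ^ thm2Exponent C (∏ q ∈ S, (q : ℝ)) := by
  set ℓ₀ : ℝ := Real.log (Real.log (Real.log 16)) with hℓ₀def
  have hℓ₀ : 0 < ℓ₀ := log_log_log_pos le_rfl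
  have hlogK : 0 ≤ Real.log K := Real.log_nonneg hK
  have hK0 : 0 < K := by linarith
  refine ⟨(129 + 62 * Real.log K) / ℓ₀ + 60, by positivity, fun S hS h6 => ?_⟩
  set G := ∏ q ∈ S, (q : ℝ) with hGdef
  set L := Real.log G with hLdef
  set u := Real.log L with hudef
  set ℓ := Real.log (Real.log (Real.log (max G 16))) with hℓdef
  set PL := ∏ q ∈ S, Real.log ((max 4 q : ℕ) : ℝ) with hPLdef
  have hG0 : 0 < G := by linarith
  have hL1 : 1 < L := by
    rw [hLdef, Real.lt_log_iff_exp_lt hG0]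
    have := Real.exp_one_lt_d9
    linarith
  have hL0 : 0 < L := by linarith
  have hu0 : 0 < u := Real.log_pos hL1
  have hℓ : ℓ₀ ≤ ℓ := log₃_sixteen_le G
  have hℓpos : 0 < ℓ := lt_of_lt_of_le hℓ₀ hℓ
  have hne : S.Nonempty := by
    by_contra h0
    rw [Finset.not_nonempty_iff_eq_empty] at h0
    have : G = 1 := by rw [hGdef, h0, Finset.prod_empty]
    linarith
  have hω0 : (0 : ℝ) < S.card := by exact_mod_cast Finset.card_pos.mpr hne
  -- the unit `E = F · ℓ`, `F = L / u ≥ 1`, and `D = E / ℓ₀ ≥ F`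
  set F := L / u with hFdef
  set E := F * ℓ with hEdef
  set D := E / ℓ₀ with hDdef
  have hF1 : 1 ≤ F := by
    rw [hFdef, le_div_iff₀ hu0, one_mul]
    linarith [Real.log_le_sub_one_of_pos hL0]
  have hF0 : 0 ≤ F := by linarith
  have hFD : F ≤ D := by
    rw [hDdef, le_div_iff₀ hℓ₀, hEdef]
    exact mul_le_mul_of_nonneg_left hℓ hF0
  have hE0 : 0 ≤ E := by positivity
  -- (A) `ω ≤ 30 F`
  have hA : (S.card : ℝ) ≤ 30 * F := by
    have h1 : (S.card : ℝ) ≤ 30 * L / u := card_le_thirty_mul_log_div hS hL1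
    rw [hFdef, ← mul_div_assoc]
    exact h1
  -- (KL) `log Π ≤ 30 E + 30 D`
  have hKL : Real.log PL ≤ 30 * E + 30 * D := by
    have h1 : ∑ q ∈ S, Real.log (Real.log ((max 4 q : ℕ) : ℝ)) ≤
        30 * L / u * (max 0 (Real.log u) + 1) := sum_log_log_le hS hL1
    have hlogPL : Real.log PL = ∑ q ∈ S, Real.log (Real.log ((max 4 q : ℕ) : ℝ)) := by
      rw [hPLdef, Real.log_prod]
      exact fun q _ => (log_max_four_pos q).ne'
    have hm : max 0 (Real.log u) ≤ ℓ := max_zero_log_log_le hG0 hL1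
    rw [hlogPL]
    calc ∑ q ∈ S, Real.log (Real.log ((max 4 q : ℕ) : ℝ))
        ≤ 30 * L / u * (max 0 (Real.log u) + 1) := h1
      _ = 30 * F * (max 0 (Real.log u) + 1) := by rw [hFdef, ← mul_div_assoc]
      _ ≤ 30 * F * (ℓ + ℓ / ℓ₀) := by
          apply mul_le_mul_of_nonneg_left _ (by positivity)
          have : 1 ≤ ℓ / ℓ₀ := by rw [le_div_iff₀ hℓ₀, one_mul]; exact hℓ
          linarith [hm]
      _ = 30 * E + 30 * D := by rw [hDdef, hEdef]; ring
  -- (B) `(ω + 1) log K ≤ 31 F log K`, (C) `log ω ≤ 30 F`, (D) `u ≤ 4 F`, (E) `log 128 ≤ 5 F`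
  have hB : ((S.card : ℝ) + 1) * Real.log K ≤ 31 * F * Real.log K := by
    apply mul_le_mul_of_nonneg_right _ hlogK
    linarith
  have hC : Real.log (S.card : ℝ) ≤ 30 * F := by
    have := Real.log_le_sub_one_of_pos hω0
    linarith
  have hD : u ≤ 4 * F := by
    have h1 : Real.log L ≤ 4 * L / Real.log L := log_le_four_mul_div_log hL1
    rw [hFdef, ← mul_div_assoc]
    exact h1
  have h128 : Real.log 128 ≤ 5 * F := by
    have he : (2.7 : ℝ) < Real.exp 1 := by have := Real.exp_one_gt_d9; linarith
    have h5 : Real.exp 5 = Real.exp 1 ^ 5 := by rw [← Real.exp_nat_mul]; norm_num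
    have h27 : (2.7 : ℝ) ^ 5 < Real.exp 1 ^ 5 := pow_lt_pow_left₀ he (by norm_num) (by norm_num)
    have hlt : (128 : ℝ) < Real.exp 5 := by rw [h5]; linarith [show (128 : ℝ) < 2.7 ^ 5 by norm_num]
    have hlog : Real.log 128 < 5 := by
      rw [Real.log_lt_iff_lt_exp (by norm_num)]; exact hlt
    linarith
  -- `log` of the left-hand side
  have hPL1 : 1 ≤ PL := one_le_prod_log_max_four S
  have hPL0 : 0 < PL := by linarith
  set M := K ^ (S.card + 1) * PL with hMdef
  have hM0 : 0 < M := mul_pos (pow_pos hK0 _) hPL0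
  have hQpos : 0 < 128 * M ^ 2 * (S.card : ℝ) ^ 2 * L := by positivity
  have hlogM : Real.log M = ((S.card : ℝ) + 1) * Real.log K + Real.log PL := by
    rw [hMdef, Real.log_mul (pow_pos hK0 _).ne' hPL0.ne', Real.log_pow]
    push_cast
    ring
  have hlogQ : Real.log (128 * M ^ 2 * (S.card : ℝ) ^ 2 * L) =
      Real.log 128 + 2 * Real.log M + 2 * Real.log (S.card : ℝ) + u := by
    have h1 : (128 : ℝ) * M ^ 2 ≠ 0 := (mul_pos (by norm_num) (pow_pos hM0 2)).ne'
    have h2 : (128 : ℝ) * M ^ 2 * (S.card : ℝ) ^ 2 ≠ 0 :=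
      (mul_pos (mul_pos (by norm_num) (pow_pos hM0 2)) (pow_pos hω0 2)).ne'
    rw [Real.log_mul h2 hL0.ne', Real.log_mul h1 (pow_pos hω0 2).ne',
      Real.log_mul (by norm_num) (pow_pos hM0 2).ne', Real.log_pow, Real.log_pow]
    push_cast
    ring
  -- assemble
  have hmain : Real.log 128 + 2 * (((S.card : ℝ) + 1) * Real.log K + Real.log PL) +
      2 * Real.log (S.card : ℝ) + u ≤ (129 + 62 * Real.log K) * D + 60 * E := by
    have hco : (69 + 62 * Real.log K) * F ≤ (69 + 62 * Real.log K) * D :=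
      mul_le_mul_of_nonneg_left hFD (by positivity)
    linarith [hB, hKL, hC, hD, h128, hco]
  have hCE : (129 + 62 * Real.log K) * D + 60 * E =
      L * (((129 + 62 * Real.log K) / ℓ₀ + 60) * ℓ / u) := by
    rw [hDdef, hEdef, hFdef]
    ring
  have hexp : thm2Exponent ((129 + 62 * Real.log K) / ℓ₀ + 60) G =
      ((129 + 62 * Real.log K) / ℓ₀ + 60) * ℓ / u := rfl
  rw [hexp, ← Real.exp_log hQpos, Real.rpow_def_of_pos hG0, Real.exp_le_exp, hlogQ, hlogM]
  show Real.log 128 + 2 * (((S.card : ℝ) + 1) * Real.log K + Real.log PL) +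
      2 * Real.log (S.card : ℝ) + u ≤ L * (((129 + 62 * Real.log K) / ℓ₀ + 60) * ℓ / u)
  rw [← hCE]
  exact hmain

end StewartYu2001

end Literature.NumberTheory.DiophantineGeometry

end
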